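import Summits.ResolutionOfSingularities.ResolutionOfSingularities.Theorems.PurelyInseparableDim4FreeTailLemma
import Summits.ResolutionOfSingularities.ResolutionOfSingularities.Theorems.PurelyInseparableDim4IsolationCert
import HarnessLib

/-!
# Purely inseparable dim 4 — the PROXIMITY BUDGET of an isolated state along a witnessed chain

The quantitative envelope of the arc argument of the free-tail lemma (p-5, `FreeTailProof`, p659995):
test arcs pushed down a witnessed `Step0 p` segment `c k₀ ⟶ ⋯ ⟶ c (k₀+d+1)` from the GENERIC top arc
`t·(1,1,1,1)` stay of the shape `Λ_i = t^{e_i}·(unit)`, with the exponent vector transformed at each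
blow-up substitution `σ_{j,b}` (`y_i ↦ y_j (y_i + b_i)`, `y_j ↦ y_j`) by

  `e'_j = e_j`,  `e'_i = e_j + (e_i if b_i = 0, else 0)`       (`expStep`),

so that the chart coordinate has the least order `M_ℓ = e_{ℓ+1}(j ℓ)` at level `ℓ` (`mult`).  One step
down the Hasse derivatives of order `< p` gain divisibility by `t^{M_ℓ}` (`arc_step_of_dvd`: the factor
`y_j^{p−|γ|}` of the transfer identity, `p − |γ| ≥ 1`), hence by `t^{gain}` over the segment,
`gain = Σ_ℓ M_ℓ` (`gain`, `arc_segment`).  Reading a certificate `𝔪₀ᴺ ≤ J_p⁺(F_{k₀}) + 𝔪₀ᴺ⁺¹` on the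
coordinate `x_{j k₀}` (exact order `N·M_{k₀}` along the bottom arc) gives

* **`proximity_budget`:  `Σ_{ℓ = k₀}^{k₀+d} M_ℓ ≤ N · M_{k₀}`**  for every `k₀`, `d` and every
  certificate exponent `N` of `c k₀` (no freeness assumed).

`M` is constant across a FREE step and grows across a SATELLITE one, `M_ℓ ≥ M_{ℓ+1} + M_{ℓ+2}`
(`mult_succ_of_not_isSatellite`, `mult_lt_of_isSatellite`, `mult_add_mult_le_of_isSatellite`), so for an all-free segment the budget
is p-5's `d + 1 ≤ N` (FT, quantitative form: `gain_eq_of_free`), while across satellites it couples the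
free blocks (e.g. `2L₁ + 2 + L₂ ≤ 2N` over one simple satellite).  Honest limit: for the alternating
all-satellite pattern `Σ M_ℓ / M_{k₀} → φ² ≈ 2.62`, so the budget alone does not exclude `ē ≡ 2`
traps (E2); it is a constraint, not a closer.  Census (p-9 HOME/census/run5b.py, 𝔽₃, q = p = 3):
0 violations / 2 138 windows.

OURS (cell res-dim4-pi, seat p-9); nothing here proves E2(3,3), `NoIsolatedTrap 3 3`, or resolution of
singularities in dimension `≥ 4` / characteristic `p`.  Supports stmt-ResolutionOfSingularities-16155 (helper).
-/

set_option linter.dupNamespace false -- mandated namespace of this single-conjunct summit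

namespace Summit.ResolutionOfSingularities.ResolutionOfSingularities.Theorems.PIDim4

namespace ProximityBudget

open MvPolynomial Finset
open Literature.AlgebraicGeometry
open Literature.AlgebraicGeometry.Resolution

variable {K : Type} [Field K]

/-! ## 1. Exponent bookkeeping of the test arcs -/

/-- One blow-up substitution `σ_{j,b}` on exponent vectors: `e'_j = e_j`, `e'_i = e_j + e_i` if `b_i = 0`
and `e'_i = e_j` if `b_i ≠ 0` (the `t`-orders of `Λ_j` and `Λ_j (Λ_i + b_i)`). [OURS · definition] -/
def expStep [DecidableEq K] (j : Fin 4) (b : Fin 4 → K) (e : Fin 4 → ℕ) : Fin 4 → ℕ :=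
  fun i => if i = j then e j else e j + if b i = 0 then e i else 0

/-- **Exponent vector at level `ℓ`** of the test arc built down from `t·(1,1,1,1)` at level `ℓ + d`
along the witnesses `(j, b)` of a chain. [OURS · definition] -/
def expo [DecidableEq K] (j : ℕ → Fin 4) (b : ℕ → Fin 4 → K) : ℕ → ℕ → (Fin 4 → ℕ)
  | _, 0 => fun _ => 1
  | ℓ, d + 1 => expStep (j ℓ) (b ℓ) (expo j b (ℓ + 1) d)

/-- **The multiplicity `M_ℓ`** of the test arc at level `ℓ` (top at level `ℓ + 1 + d`): the order of
its `j ℓ`-component, which is the least one (`mult_le_expo`). [OURS · definition] -/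
def mult [DecidableEq K] (j : ℕ → Fin 4) (b : ℕ → Fin 4 → K) (ℓ d : ℕ) : ℕ :=
  expo j b (ℓ + 1) d (j ℓ)

/-- **The accumulated gain** `Σ_{i < d} M_{ℓ+i}` of a segment of `d` steps above level `ℓ` (top arc at
level `ℓ + d`). [OURS · definition] -/
def gain [DecidableEq K] (j : ℕ → Fin 4) (b : ℕ → Fin 4 → K) : ℕ → ℕ → ℕ
  | _, 0 => 0
  | ℓ, d + 1 => gain j b (ℓ + 1) d + mult j b ℓ d

section Bookkeeping

variable [DecidableEq K] (j : ℕ → Fin 4) (b : ℕ → Fin 4 → K)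

/-- `expo` one level down is `expStep` (definitional). [OURS] -/
theorem expo_succ (ℓ d : ℕ) : expo j b ℓ (d + 1) = expStep (j ℓ) (b ℓ) (expo j b (ℓ + 1) d) := rfl

/-- `gain` one level down (definitional). [OURS] -/
theorem gain_succ (ℓ d : ℕ) : gain j b ℓ (d + 1) = gain j b (ℓ + 1) d + mult j b ℓ d := rfl

/-- `gain` of the empty segment (definitional). [OURS] -/
theorem gain_zero (ℓ : ℕ) : gain j b ℓ 0 = 0 := rfl

/-- Every exponent is `≥ 1` (all test arcs pass through the origin). [OURS] -/
theorem one_le_expo (ℓ d : ℕ) (i : Fin 4) : 1 ≤ expo j b ℓ d i := by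
  induction d generalizing ℓ i with
  | zero => exact le_rfl
  | succ d ih =>
    rw [expo_succ, expStep]
    split_ifs
    · exact ih _ _
    · exact (ih (ℓ + 1) (j ℓ)).trans (Nat.le_add_right _ _)
    · exact (ih (ℓ + 1) (j ℓ)).trans (Nat.le_add_right _ _)

/-- The chart coordinate keeps its order: `e_ℓ(j ℓ) = M_ℓ`. [OURS] -/
theorem expo_succ_self (ℓ d : ℕ) : expo j b ℓ (d + 1) (j ℓ) = mult j b ℓ d := by
  rw [expo_succ, expStep, if_pos rfl, mult]

/-- `M_ℓ` is the least order at level `ℓ`. [OURS] -/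
theorem mult_le_expo (ℓ d : ℕ) (i : Fin 4) : mult j b ℓ d ≤ expo j b ℓ (d + 1) i := by
  rw [expo_succ, expStep, mult]
  split_ifs
  · exact le_rfl
  · exact Nat.le_add_right _ _
  · exact Nat.le_add_right _ _

/-- **Across a FREE step the multiplicity is unchanged**: `¬ IsSatellite j b ℓ ⇒ M_ℓ = M_{ℓ+1}`
(same top). [OURS] -/
theorem mult_succ_of_not_isSatellite {ℓ : ℕ} (h : ¬ FreeTail.IsSatellite j b ℓ) (d : ℕ) :
    mult j b ℓ (d + 1) = mult j b (ℓ + 1) d := by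
  rw [mult, expo_succ, expStep, mult]
  by_cases hjj : j ℓ = j (ℓ + 1)
  · rw [if_pos hjj, ← hjj]
  · rw [if_neg hjj]
    have hb : b (ℓ + 1) (j ℓ) ≠ 0 := fun hb0 => h ⟨Ne.symm hjj, hb0⟩
    rw [if_neg hb, add_zero]

/-- **Across a SATELLITE step the multiplicity strictly increases** (same top): the `j ℓ`-component
one level up is not the chart coordinate there and picks up the extra order of `Λ^{(ℓ+2)}_{j ℓ} ≥ 1`.
[OURS] -/
theorem mult_lt_of_isSatellite {ℓ : ℕ} (h : FreeTail.IsSatellite j b ℓ) (d : ℕ) :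
    mult j b (ℓ + 1) d < mult j b ℓ (d + 1) := by
  obtain ⟨hjj, hb0⟩ := h
  show expo j b (ℓ + 1 + 1) d (j (ℓ + 1)) < expo j b (ℓ + 1) (d + 1) (j ℓ)
  rw [expo_succ, expStep, if_neg (Ne.symm hjj), if_pos hb0]
  have := one_le_expo j b (ℓ + 1 + 1) d (j ℓ)
  omega

/-- **Fibonacci growth across a SATELLITE step**: `IsSatellite j b ℓ ⇒ M_{ℓ+1} + M_{ℓ+2} ≤ M_ℓ` (same
top; the extra order of `Λ^{(ℓ+2)}_{j ℓ}` is at least the least order `M_{ℓ+2}` at level `ℓ + 2`) — the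
source of the `φ²` limit of the budget on alternating satellite patterns. [OURS] -/
theorem mult_add_mult_le_of_isSatellite {ℓ : ℕ} (h : FreeTail.IsSatellite j b ℓ) (d : ℕ) :
    mult j b (ℓ + 1) (d + 1) + mult j b (ℓ + 2) d ≤ mult j b ℓ (d + 2) := by
  obtain ⟨hjj, hb0⟩ := h
  have hR : mult j b ℓ (d + 2) =
      expo j b (ℓ + 1 + 1) (d + 1) (j (ℓ + 1)) + expo j b (ℓ + 1 + 1) (d + 1) (j ℓ) := by
    show expStep (j (ℓ + 1)) (b (ℓ + 1)) (expo j b (ℓ + 1 + 1) (d + 1)) (j ℓ) = _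
    rw [expStep, if_neg (Ne.symm hjj), if_pos hb0]
  rw [hR]
  exact Nat.add_le_add_left (mult_le_expo j b (ℓ + 2) d (j ℓ)) _

/-- **A free segment gains exactly its length**: if the steps `ℓ, …, ℓ+d−1` are all free then
`M ≡ 1` on the segment and `gain = d` — p-5's FT count. [OURS] -/
theorem gain_eq_of_free (d ℓ : ℕ) (hfree : ∀ m, ℓ ≤ m → m < ℓ + d → ¬ FreeTail.IsSatellite j b m) :
    mult j b ℓ d = 1 ∧ gain j b ℓ (d + 1) = d + 1 := by
  induction d generalizing ℓ with
  | zero => exact ⟨rfl, rfl⟩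
  | succ d ih =>
    obtain ⟨hm, hg⟩ := ih (ℓ + 1) fun m hm1 hm2 => hfree m (by omega) (by omega)
    have h1 : mult j b ℓ (d + 1) = 1 := by
      rw [mult_succ_of_not_isSatellite j b (hfree ℓ le_rfl (by omega)), hm]
    refine ⟨h1, ?_⟩
    rw [gain_succ, hg, h1]

end Bookkeeping

/-! ## 2. One step down a polynomial arc, with the true gain `ord_t Λ_j` -/

/-- **One step down, general gain** (p-5's `FreeTailProof.arc_step` with the exponent made explicit):
for a state `s` of order `≥ p`, a point `(j, b)` (`b_j = 0`), its cleaned successor `s⁺` and an arc `Λ`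
at the level of `s⁺` with `Λ_j ≠ 0` and `t^a ∣ Λ_j`: if `t^m ∣ D^{(β)}F⁺(Λ)` for all `0 < |β| < p`, then
`t^{m+a} ∣ D^{(γ)}F(σ_{j,b}∘Λ)` for all `0 < |γ| < p` (the transfer identity leaves the factor
`Λ_j^{p−|γ|}`, `p − |γ| ≥ 1`).  The proof is p-5's, up to the last line. [OURS] -/
theorem arc_step_of_dvd (p : ℕ) [Fact p.Prime] [CharP K p] [DecidableEq K] (s : State K)
    (hord : (p : ℕ∞) ≤ CentreBlowup.ordAlong Finset.univ s.F) {j : Fin 4} {b : Fin 4 → K}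
    (hbj : b j = 0) {Λ : Fin 4 → Polynomial K} {a : ℕ} (hΛa : Polynomial.X ^ a ∣ Λ j) (hΛj : Λ j ≠ 0)
    {m : ℕ} (hdiv : ∀ β : Fin 4 →₀ ℕ, 0 < β.degree → β.degree < p →
      Polynomial.X ^ m ∣ aeval Λ (Resolution.hasseDeriv K β (CentreBlowup.step p Finset.univ j b s).F))
    {γ : Fin 4 →₀ ℕ} (hγ0 : 0 < γ.degree) (hγp : γ.degree < p) :
    Polynomial.X ^ (m + a) ∣
      aeval (fun i => if i = j then Λ j else Λ j * (Λ i + Polynomial.C (b i)))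
        (Resolution.hasseDeriv K γ s.F) := by
  classical
  set φ : MvPolynomial (Fin 4) K →ₐ[K] MvPolynomial (Fin 4) K :=
    aeval (fun i => if i = j then (X j : MvPolynomial (Fin 4) K) else X j * (X i + C (b i))) with hφ
  have hφj : φ (X j) = X j := by rw [hφ, aeval_X, if_pos rfl]
  have hφi : ∀ i, i ≠ j → φ (X i) = X j * (X i + C (b i)) := fun i hi => by
    rw [hφ, aeval_X, if_neg hi]
  set T := CentreBlowup.pointTransform p Finset.univ j b s with hT
  have hφF : φ s.F = X j ^ p * T := by
    rw [hφ, FreeTailProof.aeval_blowup_eq p j b hbj s.F hord, hT, CentreBlowup.pointTransform]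
  have hclean : ∀ β : Fin 4 →₀ ℕ, 0 < β.degree → β.degree < p →
      Resolution.hasseDeriv K β (CentreBlowup.step p Finset.univ j b s).F =
        Resolution.hasseDeriv K β T := by
    intro β h0 hp'
    rw [← Equimultiple.hasseDeriv_eq, ← Equimultiple.hasseDeriv_eq]
    exact IsolatedBand.hasseDeriv_deletePthPowers p T h0 hp'
  have hγne : γ ≠ 0 := by
    rintro rfl
    rw [map_zero] at hγ0
    exact lt_irrefl 0 hγ0
  have hmem := BlowupHasse.map_hasseDeriv_mul_X_pow_mem_span j b φ hφj hφi s.F hγne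
  have hmap := Ideal.mem_map_of_mem (aeval Λ).toRingHom hmem
  rw [Ideal.map_span] at hmap
  have hle : Ideal.span ((aeval Λ).toRingHom '' {g | ∃ β : Fin 4 →₀ ℕ, 0 < β.degree ∧
      β.degree ≤ γ.degree ∧ g = Resolution.hasseDeriv K β (φ s.F)}) ≤
      Ideal.span {Λ j ^ p * Polynomial.X ^ m} := by
    rw [Ideal.span_le]
    rintro _ ⟨g, ⟨β, hβ0, hβle, rfl⟩, rfl⟩
    have hβp : β.degree < p := lt_of_le_of_lt hβle hγp
    rw [SetLike.mem_coe, Ideal.mem_span_singleton]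
    show Λ j ^ p * Polynomial.X ^ m ∣ aeval Λ (Resolution.hasseDeriv K β (φ s.F))
    rw [hφF, FreeTailProof.hasseDeriv_X_pow_mul p j T hβp, map_mul, map_pow, aeval_X, ← hclean β hβ0 hβp]
    exact mul_dvd_mul_left _ (hdiv β hβ0 hβp)
  have h2 := hle hmap
  rw [Ideal.mem_span_singleton] at h2
  have h2' : Λ j ^ p * Polynomial.X ^ m ∣
      aeval (fun i => if i = j then Λ j else Λ j * (Λ i + Polynomial.C (b i)))
        (Resolution.hasseDeriv K γ s.F) * Λ j ^ γ.degree := by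
    have h := h2
    rw [AlgHom.toRingHom_eq_coe, RingHom.coe_coe, map_mul, map_pow, aeval_X, hφ,
      FreeTailProof.aeval_comp_blowup] at h
    exact h
  have hsplit : Λ j ^ p = Λ j ^ γ.degree * Λ j ^ (p - γ.degree) := by
    rw [← pow_add, Nat.add_sub_cancel' hγp.le]
  rw [hsplit, mul_assoc, mul_comm (aeval _ _) _] at h2'
  have h3 := (mul_dvd_mul_iff_left (pow_ne_zero _ hΛj)).mp h2'
  have hX : Polynomial.X ^ a ∣ Λ j ^ (p - γ.degree) := dvd_pow hΛa (Nat.sub_ne_zero_of_lt hγp)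
  rw [add_comm, pow_add]
  exact dvd_trans (mul_dvd_mul hX dvd_rfl) h3

/-! ## 3. The test arcs of a segment: shape `Λ_i = t^{e_i} · unit` -/

/-- **Shape of the pushed-down arc.**  If every `Λ_i = t^{e_i}·u_i` with `u_i(0) ≠ 0` and `e_i ≥ 1`,
then `σ_{j,b}∘Λ` has the same shape with exponents `expStep j b e`. [OURS] -/
theorem arc_shape_step [DecidableEq K] (j : Fin 4) (b : Fin 4 → K) {Λ : Fin 4 → Polynomial K}
    {e : Fin 4 → ℕ} (he : ∀ i, 1 ≤ e i)
    (hΛ : ∀ i, ∃ u : Polynomial K, u.coeff 0 ≠ 0 ∧ Λ i = Polynomial.X ^ e i * u) (i : Fin 4) :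
    ∃ u : Polynomial K, u.coeff 0 ≠ 0 ∧
      (if i = j then Λ j else Λ j * (Λ i + Polynomial.C (b i))) = Polynomial.X ^ expStep j b e i * u := by
  obtain ⟨uj, huj0, huj⟩ := hΛ j
  by_cases hij : i = j
  · subst hij
    refine ⟨uj, huj0, ?_⟩
    rw [if_pos rfl, expStep, if_pos rfl, huj]
  obtain ⟨ui, hui0, hui⟩ := hΛ i
  rw [if_neg hij, expStep, if_neg hij]
  by_cases hb : b i = 0
  · refine ⟨uj * ui, ?_, ?_⟩
    · rw [Polynomial.mul_coeff_zero]
      exact mul_ne_zero huj0 hui0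
    · rw [if_pos hb, hb, map_zero, add_zero, huj, hui, pow_add]; ring
  · refine ⟨uj * (Polynomial.X ^ e i * ui + Polynomial.C (b i)), ?_, ?_⟩
    · rw [Polynomial.mul_coeff_zero, Polynomial.coeff_add, Polynomial.coeff_C_zero,
        Polynomial.coeff_X_pow_mul', if_neg (by have := he i; omega), zero_add]
      exact mul_ne_zero huj0 hb
    · rw [if_neg hb, add_zero, huj, hui]; ring

/-- **The test arc of a segment.**  Along a witnessed chain, for every level `ℓ` and depth `d` there is
a polynomial arc `Λ` at level `ℓ` of shape `Λ_i = t^{expo ℓ d i}·(unit)` along which every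
`D^{(γ)}F_ℓ`, `0 < |γ| < p`, vanishes to order `≥ gain ℓ d` (top arc `t·(1,1,1,1)` at level `ℓ + d`,
pushed down by `arc_step_of_dvd`).  No freeness is assumed. [OURS] -/
theorem arc_segment (p : ℕ) [Fact p.Prime] [CharP K p] [DecidableEq K] {c : ℕ → State K}
    {j : ℕ → Fin 4} {b : ℕ → Fin 4 → K} (hw : FreeTail.IsWitnessedChain p c j b) (d ℓ : ℕ) :
    ∃ Λ : Fin 4 → Polynomial K,
      (∀ i, ∃ u : Polynomial K, u.coeff 0 ≠ 0 ∧ Λ i = Polynomial.X ^ expo j b ℓ d i * u) ∧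
      ∀ γ : Fin 4 →₀ ℕ, 0 < γ.degree → γ.degree < p →
        Polynomial.X ^ gain j b ℓ d ∣ aeval Λ (Resolution.hasseDeriv K γ (c ℓ).F) := by
  induction d generalizing ℓ with
  | zero =>
    refine ⟨fun _ => Polynomial.X, fun i => ⟨1, ?_, ?_⟩, fun γ _ _ => ?_⟩
    · rw [Polynomial.coeff_one_zero]; exact one_ne_zero
    · show Polynomial.X = Polynomial.X ^ 1 * 1
      rw [pow_one, mul_one]
    · show Polynomial.X ^ 0 ∣ _
      rw [pow_zero]; exact one_dvd _
  | succ d ih =>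
    obtain ⟨hord, hbj, -, -, hc⟩ := hw ℓ
    obtain ⟨Λ, hΛ, hdiv⟩ := ih (ℓ + 1)
    obtain ⟨u, hu0, hu⟩ := hΛ (j ℓ)
    have hΛj : Λ (j ℓ) ≠ 0 := by
      rw [hu]
      refine mul_ne_zero (pow_ne_zero _ Polynomial.X_ne_zero) fun h => ?_
      rw [h, Polynomial.coeff_zero] at hu0
      exact hu0 rfl
    have hΛa : Polynomial.X ^ mult j b ℓ d ∣ Λ (j ℓ) := ⟨u, by rw [hu, mult]⟩
    refine ⟨fun i => if i = j ℓ then Λ (j ℓ) else Λ (j ℓ) * (Λ i + Polynomial.C (b ℓ i)),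
      fun i => ?_, fun γ hγ0 hγp => ?_⟩
    · rw [expo_succ]
      exact arc_shape_step (j ℓ) (b ℓ) (fun i => one_le_expo j b (ℓ + 1) d i) hΛ i
    · rw [gain_succ]
      refine arc_step_of_dvd p (c ℓ) hord hbj hΛa hΛj (m := gain j b (ℓ + 1) d)
        (fun β hβ0 hβp => ?_) hγ0 hγp
      rw [← hc]
      exact hdiv β hβ0 hβp

/-! ## 4. The proximity budget -/

/-- Along an arc all of whose components are divisible by `t^M`, the elements of `𝔪₀ᵏ` become
multiples of `t^{M k}`. [folklore] -/
theorem dvd_aeval_of_mem_originIdeal_pow {Λ : Fin 4 → Polynomial K} {M : ℕ}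
    (hΛ : ∀ i, Polynomial.X ^ M ∣ Λ i) {k : ℕ} {g : MvPolynomial (Fin 4) K}
    (hg : g ∈ originIdeal K ^ k) : Polynomial.X ^ (M * k) ∣ aeval Λ g := by
  have hle : (originIdeal K).map (aeval Λ).toRingHom ≤
      Ideal.span {(Polynomial.X : Polynomial K) ^ M} := by
    rw [IsolationCert.originIdeal_eq_idealOfVars, MvPolynomial.idealOfVars, Ideal.map_span,
      Ideal.span_le]
    rintro _ ⟨_, ⟨i, rfl⟩, rfl⟩
    rw [SetLike.mem_coe, Ideal.mem_span_singleton, AlgHom.toRingHom_eq_coe, RingHom.coe_coe, aeval_X]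
    exact hΛ i
  have h1 : (aeval Λ).toRingHom g ∈ ((originIdeal K) ^ k).map (aeval Λ).toRingHom :=
    Ideal.mem_map_of_mem _ hg
  rw [Ideal.map_pow] at h1
  have h2 := Ideal.pow_right_mono hle k h1
  rw [Ideal.span_singleton_pow, Ideal.mem_span_singleton, ← pow_mul] at h2
  exact h2

/-- **THE PROXIMITY BUDGET.**  Along a witnessed `Step0 p` chain (characteristic `p`), for every
level `k₀`, every depth `d` and every certificate exponent `N` of `c k₀`
(`𝔪₀ᴺ ≤ J_p⁺(F_{k₀}) + 𝔪₀ᴺ⁺¹`):  **`Σ_{ℓ = k₀}^{k₀+d} M_ℓ ≤ N · M_{k₀}`**, i.e.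
`gain j b k₀ (d+1) ≤ N * mult j b k₀ d` — the multiplicities `M_ℓ` of the test arcs of the segment
`k₀ … k₀+d+1` (constant across free steps, strictly increasing, Fibonacci-like, across satellites) are
budgeted by the certificate.  Proof: `x_{j k₀}^N = g + r` with `g ∈ J⁺`, `r ∈ 𝔪₀ᴺ⁺¹`; along the bottom arc
`x_{j k₀} = t^M·u`, `u(0) ≠ 0`, `t^{gain} ∣ g(Λ)`, `t^{M(N+1)} ∣ r(Λ)`; if `gain > N·M` then
`t^{NM+1} ∣ t^{NM} u^N`, absurd. [OURS] -/
theorem proximity_budget (p : ℕ) [Fact p.Prime] [CharP K p] [DecidableEq K] {c : ℕ → State K}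
    {j : ℕ → Fin 4} {b : ℕ → Fin 4 → K} (hw : FreeTail.IsWitnessedChain p c j b) (k₀ d N : ℕ)
    (hN : originIdeal K ^ N ≤ singLocusIdeal p (c k₀).F ⊔ originIdeal K ^ (N + 1)) :
    gain j b k₀ (d + 1) ≤ N * mult j b k₀ d := by
  classical
  by_contra hlt
  rw [not_le] at hlt
  obtain ⟨Λ, hΛ, hdiv⟩ := arc_segment p hw (d + 1) k₀
  set M := mult j b k₀ d with hM
  -- every component is divisible by `t^M`, the chart coordinate is exactly `t^M · unit`
  have hΛM : ∀ i, Polynomial.X ^ M ∣ Λ i := fun i => by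
    obtain ⟨u, -, hu⟩ := hΛ i
    exact dvd_trans (pow_dvd_pow _ (mult_le_expo j b k₀ d i)) ⟨u, hu⟩
  obtain ⟨u, hu0, hu⟩ := hΛ (j k₀)
  rw [expo_succ_self] at hu
  have hXmem : (X (j k₀) : MvPolynomial (Fin 4) K) ∈ originIdeal K := by
    rw [originIdeal, RingHom.mem_ker, MvPolynomial.eval_X]
    rfl
  obtain ⟨g, hg, r, hr, hgr⟩ := Submodule.mem_sup.mp (hN (Ideal.pow_mem_pow hXmem N))
  have hdvd_g : Polynomial.X ^ (N * M + 1) ∣ aeval Λ g := by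
    have hle : singLocusIdeal p (c k₀).F ≤
        (Ideal.span {(Polynomial.X : Polynomial K) ^ (N * M + 1)}).comap (aeval Λ).toRingHom := by
      rw [singLocusIdeal, Ideal.span_le]
      rintro _ ⟨α, hα0, hαp, rfl⟩
      rw [SetLike.mem_coe, Ideal.mem_comap, Ideal.mem_span_singleton, Equimultiple.hasseDeriv_eq]
      exact dvd_trans (pow_dvd_pow _ (by omega)) (hdiv α hα0 hαp)
    have h := hle hg
    rw [Ideal.mem_comap, Ideal.mem_span_singleton] at h
    exact h
  have hdvd_r : Polynomial.X ^ (N * M + 1) ∣ aeval Λ r := by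
    have h := dvd_aeval_of_mem_originIdeal_pow hΛM hr
    refine dvd_trans (pow_dvd_pow _ ?_) h
    have h1 : 1 ≤ M := hM ▸ (one_le_expo j b (k₀ + 1) d (j k₀))
    nlinarith
  have hdvd : Polynomial.X ^ (N * M + 1) ∣ Λ (j k₀) ^ N := by
    have h := congrArg (aeval Λ) hgr
    rw [map_add, map_pow, aeval_X] at h
    rw [← h]
    exact dvd_add hdvd_g hdvd_r
  rw [hu, mul_pow, ← pow_mul, mul_comm M N, pow_succ] at hdvd
  have h3 := (mul_dvd_mul_iff_left (pow_ne_zero (N * M) Polynomial.X_ne_zero)).mp hdvd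
  rw [Polynomial.X_dvd_iff, Polynomial.coeff_zero_eq_eval_zero, Polynomial.eval_pow,
    ← Polynomial.coeff_zero_eq_eval_zero] at h3
  exact hu0 (pow_eq_zero_iff'.mp h3).1

/-- **Free-block reading** (FT, quantitative): if the `d + 1` steps `k₀, …, k₀+d` are all free, then
`d + 1 ≤ N` for every certificate exponent `N` of `c k₀` — p-5's count, recovered from the budget.
[OURS] -/
theorem free_block_le (p : ℕ) [Fact p.Prime] [CharP K p] [DecidableEq K] {c : ℕ → State K}
    {j : ℕ → Fin 4} {b : ℕ → Fin 4 → K} (hw : FreeTail.IsWitnessedChain p c j b) (k₀ d N : ℕ)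
    (hN : originIdeal K ^ N ≤ singLocusIdeal p (c k₀).F ⊔ originIdeal K ^ (N + 1))
    (hfree : ∀ m, k₀ ≤ m → m < k₀ + d → ¬ FreeTail.IsSatellite j b m) : d + 1 ≤ N := by
  have h := proximity_budget p hw k₀ d N hN
  obtain ⟨hm, hg⟩ := gain_eq_of_free j b d k₀ hfree
  rw [hg, hm, mul_one] at h
  exact h

end ProximityBudget

end Summit.ResolutionOfSingularities.ResolutionOfSingularities.Theorems.PIDim4
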